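import Mathlib
import Summits.Ventures.PercRepro2.HCov
import Summits.Ventures.PercRepro2.A3Inactive
import Summits.Ventures.PercRepro2.A3FibreWorlds
import Summits.Ventures.PercRepro2.DiagBA3
import Summits.Ventures.PercRepro2.A3RootEdge
import Summits.Ventures.PercRepro2.RootEdgeBern
import Summits.Ventures.PercRepro2.HCovPlusQuartic
import Summits.Ventures.PercRepro2.QuarticRootCross
import Summits.Ventures.PercRepro2.QuarticRootCrossOL
import Summits.Ventures.PercRepro2.QuarticRootSlack

/-!
# `slackBm ≥ 0` AT A ROOT EDGE IS A THEOREM — FOUR BHK SLACKS OF THE CLOSED PIN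
(blind cell PercRepro2, p5 g18; `proofs/P5-OEDGE.md` §24 (C4))

`QuarticRootSlack.slackBm_root_decomp` writes the middle slack coefficient of the quartic's root-edge
face (`e = {a₁, a₃}`) in the closed pin's world masses; §23 addendum 2 recorded the resulting
three-bracket form `2D₀[P(T,bH) − P(T,bL) − P(T′,bH)] + 2P(T′)[P(PD,bH) + P(T,bH) − P(T,bL)]
− 2P(T)[P(PD,bH) + P(T′,bH) − P(PD,bL) − P(PD,b↔a₃) − P(T′,bL)]` as «≥ 0 on 600 / 600, no termwise
signing». Regrouped ACROSS the brackets it is a sum of four nonnegative pieces of the closed pin: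

  `slackBm / 2 = [P(T,bH)·(D + P(T′)) − P(T)·(P(PD,bH) + P(T′,bH))]`   (BHK 1.3: `{b ∈ C₂}`, `{a₃ ∈ C₂}` under `Q`)
             `+ [P(T)·(P(PD,bL) + P(T′,bL)) − P(T,bL)·(D + P(T′))]`   (BHK 1.4: `{b ∈ C₁}`, `{a₃ ∈ C₂}` under `Q`)
             `+ [P(T′)·P(PD,bH) − D·P(T′,bH)]`                        (the margin block, `T'oH_mul_D_le` with `o := b`)
             `+ P(T)·P(PD, b ↔ a₃)`.

* **`QbH_mul_T_le`**: `P(Q,bH)·P(T) ≤ P(T,bH)·Q` (`bhk_same_cluster_events`, `s = a₂`);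
* **`slackBm_nonneg_root`**: `0 ≤ slackBm` at every root edge, every admissible weight vector;
* **`H2_nonneg_root_of_C2`**: the `H2` face of the quartic's root edge is now the single closed-pin
  inequality (C2) `δ_oH·slackBm ≤ Q₁·B1` (with `c ≥ −δ_oH` from `QuarticRootCrossOL` and
  `B2 ≥ 0`); with `QuarticRootFace.H1_nonneg_root_of` the root-edge face of `JointGood` is the
  THREE closed-pin inequalities (C2), (D5) `0 ≤ Q₀·B1 + covU₀·slackBm`, (D3) `δ_oH·slackB₀ ≤ Q₁·Gc₀`.
-/

namespace Summit.Ventures.PercRepro2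

open UnionCluster CovForm CovForm.EdgeLine CovForm.RootEdge CovForm.A3Fibre HCovPlusQuartic

namespace QuarticRootCross

section Sign

variable {V : Type*} {E : Type*} [Fintype V] [DecidableEq V] [Fintype E] [DecidableEq E]
  {R : Type*} [Field R] [LinearOrder R] [IsStrictOrderedRing R]

/-- **BHK 1.3 for `{b ∈ C₂}` and `{a₃ ∈ C₂}` under `Q`**: `P(Q, bH)·P(T) ≤ P(T, bH)·Q`
(`bhk_same_cluster_events` with `s = a₂`, `t = a₁`). -/
theorem QbH_mul_T_le (p : E → R) (hp : IsProbVec p) (ends : E → Sym2 V) (a₁ a₂ a₃ b : V) :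
    prob p (avoidAll ends a₂ {a₁} ∩ connEvent ends a₂ b) * prob p (TEvent ends a₁ a₂ a₃) ≤
      prob p (TEvent ends a₁ a₂ a₃ ∩ connEvent ends a₂ b) * prob p (avoidAll ends a₂ {a₁}) := by
  have h := bhk_same_cluster_events p hp ends a₂ a₁ (isUpperSet_mem_setOf a₃)
    (isUpperSet_mem_setOf b)
  rw [← connEvent_eq_clusterInEvent ends a₂ a₃, ← connEvent_eq_clusterInEvent ends a₂ b,
    ← avoidAll_eq_compl ends a₁ a₂] at h
  have e1 : connEvent ends a₂ a₃ ∩ avoidAll ends a₂ {a₁} = TEvent ends a₁ a₂ a₃ := by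
    rw [TEvent, avoidAll_eq_compl]; exact Set.inter_comm _ _
  have e2 : connEvent ends a₂ b ∩ avoidAll ends a₂ {a₁} =
      avoidAll ends a₂ {a₁} ∩ connEvent ends a₂ b := Set.inter_comm _ _
  have e3 : connEvent ends a₂ a₃ ∩ connEvent ends a₂ b ∩ avoidAll ends a₂ {a₁} =
      TEvent ends a₁ a₂ a₃ ∩ connEvent ends a₂ b := by
    rw [TEvent, avoidAll_eq_compl]; ext ω; simp only [Set.mem_inter_iff]; tauto
  rw [e1, e2, e3] at h
  linarith [h]

omit [Fintype V] [DecidableEq V] [Fintype E] [DecidableEq E] [LinearOrder R] [IsStrictOrderedRing R] in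
/-- `Q ∩ {a₂ ↔ a₃} = T` and `Q ∩ ({a₂ ↔ a₃} ∩ X) = T ∩ X`. -/
lemma Q_inter_conn_a2_a3_inter (ends : E → Sym2 V) (a₁ a₂ a₃ : V) (X : Set (Config E)) :
    avoidAll ends a₂ {a₁} ∩ (connEvent ends a₂ a₃ ∩ X) = TEvent ends a₁ a₂ a₃ ∩ X := by
  rw [TEvent, avoidAll_eq_compl]; ext ω; simp only [Set.mem_inter_iff]; tauto

variable {ends : E → Sym2 V} {e : E} {a₁ a₃ : V}

/-- **`0 ≤ slackBm` at a root edge, unconditionally** — four BHK slacks of the closed pin. -/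
theorem slackBm_nonneg_root (p : E → R) (hp : IsProbVec p) (hends : ends e = s(a₁, a₃)) (a₂ b : V) :
    0 ≤ slackBm p ends a₁ a₂ a₃ b e := by
  have hp₀ : IsProbVec (Function.update p e 0) := hp.update e le_rfl zero_le_one
  rw [slackBm_root_decomp p hends a₂ b, prob_one_Q_root_split p hends a₂,
    prob_one_Q_bL_root_split p hends a₂ b, prob_one_Q_bH_root_split p hends a₂ b,
    Qsplit_univ (Function.update p e 0) ends a₁ a₂ a₃,
    Qsplit (Function.update p e 0) ends a₁ a₂ a₃ (connEvent ends a₁ b),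
    Qsplit (Function.update p e 0) ends a₁ a₂ a₃ (connEvent ends a₂ b)]
  -- G1: BHK 1.3 on `C₂` for `b`, `a₃`
  have G1 := QbH_mul_T_le (Function.update p e 0) hp₀ ends a₁ a₂ a₃ b
  rw [Qsplit_univ (Function.update p e 0) ends a₁ a₂ a₃,
    Qsplit (Function.update p e 0) ends a₁ a₂ a₃ (connEvent ends a₂ b)] at G1
  -- G2: BHK 1.4 for `{b ∈ C₁}`, `{a₃ ∈ C₂}`
  have G2 := A3Inactive.bLoH_mul_Q_le (Function.update p e 0) hp₀ ends a₃ a₁ a₂ b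
  rw [Q_inter_conn_a2_a3_inter ends a₁ a₂ a₃ (connEvent ends a₁ b),
    Qsplit_univ (Function.update p e 0) ends a₁ a₂ a₃,
    Qsplit (Function.update p e 0) ends a₁ a₂ a₃ (connEvent ends a₁ b)] at G2
  have eT : avoidAll ends a₂ {a₁} ∩ connEvent ends a₂ a₃ = TEvent ends a₁ a₂ a₃ := by
    rw [TEvent, avoidAll_eq_compl]
  rw [eT] at G2
  -- G3: the margin block with `o := b`
  have G3 := DiagBA3.T'oH_mul_D_le (Function.update p e 0) hp₀ ends b a₁ a₂ a₃
  -- G4: a product of two masses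
  have G4 := mul_nonneg (prob_nonneg hp₀ (TEvent ends a₁ a₂ a₃))
    (prob_nonneg hp₀ (PDEvent ends a₁ a₂ a₃ ∩ connEvent ends a₃ b))
  nlinarith [G1, G2, G3, G4]

/-- **The `H2` face of the quartic's root edge is (C2) alone**: `δ_oH·slackBm ≤ Q₁·B1` gives `0 ≤ H2`
(`slackBm ≥ 0` now a theorem, `c ≥ −δ_oH`, `B2 ≥ 0`). -/
theorem H2_nonneg_root_of_C2 (p : E → R) (hp : IsProbVec p) (hends : ends e = s(a₁, a₃)) (o a₂ b : V)
    (hC2 : (prob (Function.update p e 0) (PDEvent ends a₁ a₂ a₃ ∩ connEvent ends a₂ o) *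
              prob (Function.update p e 0) (TEvent ends a₂ a₁ a₃) -
            prob (Function.update p e 0) (PDEvent ends a₁ a₂ a₃) *
              prob (Function.update p e 0) (TEvent ends a₂ a₁ a₃ ∩ connEvent ends a₂ o)) *
          slackBm p ends a₁ a₂ a₃ b e ≤
        prob (Function.update p e 1) (avoidAll ends a₂ {a₁}) * B1 p ends o a₁ a₂ a₃ b e) :
    0 ≤ H2 p ends o a₁ a₂ a₃ b e := by
  have hp₀ : IsProbVec (Function.update p e 0) := hp.update e le_rfl zero_le_one
  rw [H2_eq_root p hends o a₂ b, ← covUm_eq_root p hends o a₂]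
  have hc := covUm_root_add_oH_deficit_nonneg p hp hends o a₂
  have hsm := slackBm_nonneg_root p hp hends a₂ b
  have hB2 := B2_nonneg_root p hp hends o a₂ b
  have hQ0 := prob_nonneg hp₀ (avoidAll ends a₂ {a₁})
  have h1 := mul_nonneg hc hsm
  nlinarith [h1, mul_nonneg hQ0 hB2]

end Sign

end QuarticRootCross

end Summit.Ventures.PercRepro2
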